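import Summits.CriticalPhenomena.PercolationContinuityZ3.Theorems.PercNearOneGluingNoHeavyLowerTailSunflowerMultiPetal
import Summits.CriticalPhenomena.PercolationContinuityZ3.Theorems.PercNearOneGluingNoHeavyLowerTailSunflowerSpectatorRows
import HarnessLib
import HarnessLib.Audit

/-!
# `NoHeavyLowerTail` (crux stmt-CriticalPhenomena-4575), abstract sunflower cubic, `k` petals: SPECTATOR FORM of the multi-petal functional,
# ANTIPODAL GLADKOV for monotone maps into `M_k`, and the multi-petal partition lemma ★ₖ in the RAINBOW-FREE class (in particular `k ≤ 2`)

Support file (seat `prim-l12-p2` gen 26; `--supports stmt-CriticalPhenomena-4575`; companion of `…SunflowerMultiPetal` (`MSunflower`, `s6K`, `ZK`,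
`PartitionLemmaK`) and of `…SunflowerSpectatorRows` (block-relabelling symmetries `sum_parts_swap12/13`)).  No `sorry`; nothing is asserted
about the crux.  Memo: run/shared/lean/prim/prim-l12/prim-l12-p2/FINDING-g26-MULTIPETAL-COMPONENT-LEMMA.md §3.

RESULTS (all `k`, every finite `α`, every `F : MSunflower k α`):
* `s6K_eq_spec` : `s6K x y z = [x decided]·kkK y z + [y decided]·kkK x z + [z decided]·kkK x y − triK x y z` (pointwise; `kkK` the `k`-petal
  antipodal Gladkov kernel `+1` on {top,bottom}, `−1` on two distinct petals; `triK` the rainbow indicator).  Proved for general `k` by CHARTING the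
  three labels into `Fin 5` (`chart3`: top/bottom/`x ↦ 1`/`y ↦ 2`/else `3` preserves top, bottom and all equalities among `x,y,z`) and `decide` on `Fin 5`.
* `kkK_submod` : submodularity of `kkK` on comparable rectangles of `M_k` — charted into `Fin 5` (`chart2`, the two anchors of a comparable pair carry
  at most one petal) and read off the `M₃` table `kk_submod`;  `MSunflower.antipodal_sum_nonneg` / `antipodal_gladkov` : the `k`-petal antipodal
  Gladkov inequality with offsets (the induction of `Sunflower.antipodal_sum_nonneg` verbatim) — the counting form of Gladkov's strong Harris–Kleitman
  inequality `μ(A)μ(B) ≥ e₂(μ(C_1),…,μ(C_k))` [Gladkov, Bull. Lond. Math. Soc. 56 (2024) Thm 2.1] for every `k`.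
* `ZK_eq_spec` : `ZK = 3·SwK [decided] − NtriK` with `SwK w = Σ_{(P¹,P²,P³)} w(lab P¹)·kkK(lab P², lab P³) ≥ 0` for `w ≥ 0` (`SwK_nonneg`) — so the
  rainbow count `NtriK` (`= 6 ×` #ordered partitions into three pairwise distinct petals) is the ONLY negative term of ★ₖ:
  ★ₖ ⟺ `NtriK ≤ 3·SwK [decided]` ("rainbows are paid by three times the total antipodal-Gladkov slack of the decided spectators").
* `ZK_nonneg_of_NtriK_eq_zero`, `ZK_nonneg_of_le_two` : ★ₖ holds whenever there is no rainbow, in particular for `k ≤ 2` petals.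
-/
namespace Summit.CriticalPhenomena.PercolationContinuityZ3.Theorems.SunflowerPartition

open Finset

/-! ## Kernels on `Fin (k+2)` and their charts into `Fin 5` -/

/-- Indicator that a label is decided (top or bottom). [this work] -/
def decK (k : ℕ) (a : Fin (k + 2)) : ℤ := if a = Fin.last (k + 1) ∨ a = 0 then 1 else 0

/-- The `k`-petal antipodal Gladkov kernel: `+1` on {top, bottom}, `−1` on two distinct petals, `0` otherwise. [this work] -/
def kkK (k : ℕ) (a b : Fin (k + 2)) : ℤ :=
  (if a = Fin.last (k + 1) ∧ b = 0 then 1 else 0) + (if a = 0 ∧ b = Fin.last (k + 1) then 1 else 0)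
    - (if a ≠ Fin.last (k + 1) ∧ a ≠ 0 ∧ b ≠ Fin.last (k + 1) ∧ b ≠ 0 ∧ a ≠ b then 1 else 0)

/-- The rainbow indicator: three pairwise distinct petal labels. [this work] -/
def triK (k : ℕ) (x y z : Fin (k + 2)) : ℤ :=
  if x ≠ Fin.last (k + 1) ∧ x ≠ 0 ∧ y ≠ Fin.last (k + 1) ∧ y ≠ 0 ∧ z ≠ Fin.last (k + 1) ∧ z ≠ 0 ∧ x ≠ y ∧ y ≠ z ∧ x ≠ z
  then 1 else 0

/-- `kkK 3 = kk`. [this work] -/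
theorem kkK_three : ∀ a b : Fin 5, kkK 3 a b = kk a b := by decide

/-- `kkK` is symmetric. [this work] -/
theorem kkK_comm (k : ℕ) (a b : Fin (k + 2)) : kkK k a b = kkK k b a := by
  unfold kkK
  rw [if_congr (and_comm : (a = Fin.last (k + 1) ∧ b = 0) ↔ _) (Eq.refl (1 : ℤ)) (Eq.refl (0 : ℤ)),
    if_congr (and_comm : (a = 0 ∧ b = Fin.last (k + 1)) ↔ _) (Eq.refl (1 : ℤ)) (Eq.refl (0 : ℤ)),
    if_congr (show (a ≠ Fin.last (k + 1) ∧ a ≠ 0 ∧ b ≠ Fin.last (k + 1) ∧ b ≠ 0 ∧ a ≠ b) ↔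
        (b ≠ Fin.last (k + 1) ∧ b ≠ 0 ∧ a ≠ Fin.last (k + 1) ∧ a ≠ 0 ∧ b ≠ a) from
      ⟨fun h => ⟨h.2.2.1, h.2.2.2.1, h.1, h.2.1, fun e => h.2.2.2.2 e.symm⟩,
       fun h => ⟨h.2.2.1, h.2.2.2.1, h.1, h.2.1, fun e => h.2.2.2.2 e.symm⟩⟩) (Eq.refl (1 : ℤ)) (Eq.refl (0 : ℤ))]
  ring

/-- `triK ≥ 0`. [this work] -/
theorem triK_nonneg (k : ℕ) (x y z : Fin (k + 2)) : 0 ≤ triK k x y z := by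
  unfold triK; split_ifs <;> norm_num

/-- With at most two petals there are no rainbows. [this work] -/
theorem triK_eq_zero_of_le_two {k : ℕ} (hk : k ≤ 2) : ∀ x y z : Fin (k + 2), triK k x y z = 0 := by
  interval_cases k <;> decide

/-- Transport of `decK` along a top/bottom-preserving relabelling. [this work] -/
theorem decK_congr {k k' : ℕ} {a : Fin (k + 2)} {a' : Fin (k' + 2)}
    (ht : a = Fin.last (k + 1) ↔ a' = Fin.last (k' + 1)) (h0 : a = 0 ↔ a' = 0) : decK k a = decK k' a' := by
  unfold decK; exact if_congr (or_congr ht h0) rfl rfl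

/-- Transport of `kkK` along a top/bottom/equality-preserving relabelling. [this work] -/
theorem kkK_congr {k k' : ℕ} {a b : Fin (k + 2)} {a' b' : Fin (k' + 2)}
    (hat : a = Fin.last (k + 1) ↔ a' = Fin.last (k' + 1)) (ha0 : a = 0 ↔ a' = 0)
    (hbt : b = Fin.last (k + 1) ↔ b' = Fin.last (k' + 1)) (hb0 : b = 0 ↔ b' = 0) (hab : a = b ↔ a' = b') :
    kkK k a b = kkK k' a' b' := by
  unfold kkK
  rw [if_congr (and_congr hat hb0) (Eq.refl (1 : ℤ)) (Eq.refl (0 : ℤ)),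
    if_congr (and_congr ha0 hbt) (Eq.refl (1 : ℤ)) (Eq.refl (0 : ℤ)),
    if_congr (and_congr (not_congr hat) (and_congr (not_congr ha0) (and_congr (not_congr hbt)
      (and_congr (not_congr hb0) (not_congr hab))))) (Eq.refl (1 : ℤ)) (Eq.refl (0 : ℤ))]

/-- Transport of `triK`. [this work] -/
theorem triK_congr {k k' : ℕ} {x y z : Fin (k + 2)} {x' y' z' : Fin (k' + 2)}
    (hxt : x = Fin.last (k + 1) ↔ x' = Fin.last (k' + 1)) (hx0 : x = 0 ↔ x' = 0)
    (hyt : y = Fin.last (k + 1) ↔ y' = Fin.last (k' + 1)) (hy0 : y = 0 ↔ y' = 0)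
    (hzt : z = Fin.last (k + 1) ↔ z' = Fin.last (k' + 1)) (hz0 : z = 0 ↔ z' = 0)
    (hxy : x = y ↔ x' = y') (hyz : y = z ↔ y' = z') (hxz : x = z ↔ x' = z') :
    triK k x y z = triK k' x' y' z' := by
  unfold triK
  exact if_congr (and_congr (not_congr hxt) (and_congr (not_congr hx0) (and_congr (not_congr hyt) (and_congr (not_congr hy0)
    (and_congr (not_congr hzt) (and_congr (not_congr hz0) (and_congr (not_congr hxy) (and_congr (not_congr hyz) (not_congr hxz)))))))))
    rfl rfl

/-- Transport of `s6K` (equality version of `s6K_le_of_relabel`). [this work] -/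
theorem s6K_congr {k k' : ℕ} {x y z : Fin (k + 2)} {x' y' z' : Fin (k' + 2)}
    (hxt : x = Fin.last (k + 1) ↔ x' = Fin.last (k' + 1)) (hx0 : x = 0 ↔ x' = 0)
    (hyt : y = Fin.last (k + 1) ↔ y' = Fin.last (k' + 1)) (hy0 : y = 0 ↔ y' = 0)
    (hzt : z = Fin.last (k + 1) ↔ z' = Fin.last (k' + 1)) (hz0 : z = 0 ↔ z' = 0)
    (hxy : x = y ↔ x' = y') (hyz : y = z ↔ y' = z') (hxz : x = z ↔ x' = z') :
    s6K k x y z = s6K k' x' y' z' :=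
  le_antisymm (s6K_le_of_relabel hxt hx0 hyt hy0 hzt hz0 hxy.1 hxz.1 hyz.1)
    (s6K_le_of_relabel hxt.symm hx0.symm hyt.symm hy0.symm hzt.symm hz0.symm hxy.2 hxz.2 hyz.2)

/-- The chart of three labels into `Fin 5`: top `↦ 4`, bottom `↦ 0`, the (petal) value `x ↦ 1`, `y ↦ 2`, anything else `↦ 3`. [this work] -/
def chart3 (k : ℕ) (x y w : Fin (k + 2)) : Fin 5 :=
  if w = Fin.last (k + 1) then 4 else if w = 0 then 0 else if w = x then 1 else if w = y then 2 else 3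

/-- The chart detects the top label. [this work] -/
theorem chart3_eq_four_iff (k : ℕ) (x y w : Fin (k + 2)) : chart3 k x y w = 4 ↔ w = Fin.last (k + 1) := by
  unfold chart3; split_ifs <;> simp_all

/-- The chart detects the bottom label. [this work] -/
theorem chart3_eq_zero_iff (k : ℕ) (x y w : Fin (k + 2)) : chart3 k x y w = 0 ↔ w = 0 := by
  unfold chart3
  split_ifs with h1 h2
  · simp only [show (4 : Fin 5) ≠ 0 by decide, false_iff]; rintro rfl
    have := congrArg Fin.val h1; simp at this
  · simp [h2]
  all_goals simp_all

/-- The chart is injective on `{x, y, w}` for any single extra label `w`: two labels that are both "other" must coincide. [this work] -/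
theorem chart3_eq_iff (k : ℕ) (x y : Fin (k + 2)) {w w' : Fin (k + 2)}
    (hz : (w ≠ x ∧ w ≠ y) → (w' ≠ x ∧ w' ≠ y) → w = w') :
    w = w' ↔ chart3 k x y w = chart3 k x y w' := by
  constructor
  · rintro rfl; rfl
  · intro h
    unfold chart3 at h
    split_ifs at h <;> first | (subst_vars; rfl) | simp_all

/-- **Spectator form of the kernel** (pointwise): `s6K = Σ_cyc [decided]·kkK − triK`. [this work] -/
theorem s6K_eq_spec (k : ℕ) (x y z : Fin (k + 2)) :
    s6K k x y z = decK k x * kkK k y z + decK k y * kkK k x z + decK k z * kkK k x y - triK k x y z := by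
  have h5 : ∀ a b c : Fin 5, s6K 3 a b c = decK 3 a * kkK 3 b c + decK 3 b * kkK 3 a c + decK 3 c * kkK 3 a b - triK 3 a b c := by
    decide
  -- chart the three labels into `Fin 5`
  set c := chart3 k x y with hc
  have hxt := (chart3_eq_four_iff k x y x).symm; have hx0 := (chart3_eq_zero_iff k x y x).symm
  have hyt := (chart3_eq_four_iff k x y y).symm; have hy0 := (chart3_eq_zero_iff k x y y).symm
  have hzt := (chart3_eq_four_iff k x y z).symm; have hz0 := (chart3_eq_zero_iff k x y z).symm
  have hxy : x = y ↔ c x = c y := chart3_eq_iff k x y (fun h _ => absurd rfl h.1)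
  have hyz : y = z ↔ c y = c z := chart3_eq_iff k x y (fun h _ => absurd rfl h.2)
  have hxz : x = z ↔ c x = c z := chart3_eq_iff k x y (fun h _ => absurd rfl h.1)
  have e4 : (4 : Fin 5) = Fin.last (3 + 1) := rfl
  rw [e4] at hxt hyt hzt
  rw [s6K_congr hxt hx0 hyt hy0 hzt hz0 hxy hyz hxz, decK_congr hxt hx0, decK_congr hyt hy0, decK_congr hzt hz0,
    kkK_congr hyt hy0 hzt hz0 hyz, kkK_congr hxt hx0 hzt hz0 hxz, kkK_congr hxt hx0 hyt hy0 hxy,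
    triK_congr hxt hx0 hyt hy0 hzt hz0 hxy hyz hxz]
  exact h5 _ _ _

/-! ## Antipodal Gladkov for `k` petals -/

/-- `kkK` is nonnegative on comparable pairs of `M_k`. [this work] -/
theorem kkK_nonneg_of_mle {k : ℕ} (a b : Fin (k + 2)) (h : b = a ∨ b = 0 ∨ a = Fin.last (k + 1)) : 0 ≤ kkK k a b := by
  unfold kkK
  split_ifs <;> omega

/-- The chart of a comparable pair of anchors `s₀ ≤ s₁` into `Fin 5`: top `↦ 4`, bottom `↦ 0`, the anchors' petal `↦ 1`, other petals `↦ 2`.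
[this work] -/
def chart2 (k : ℕ) (s₀ s₁ w : Fin (k + 2)) : Fin 5 :=
  if w = Fin.last (k + 1) then 4 else if w = 0 then 0 else if w = s₀ ∨ w = s₁ then 1 else 2

/-- `chart2` detects the top label. [this work] -/
theorem chart2_eq_four_iff (k : ℕ) (s₀ s₁ w : Fin (k + 2)) : chart2 k s₀ s₁ w = 4 ↔ w = Fin.last (k + 1) := by
  unfold chart2; split_ifs <;> simp_all

/-- `chart2` detects the bottom label. [this work] -/
theorem chart2_eq_zero_iff (k : ℕ) (s₀ s₁ w : Fin (k + 2)) : chart2 k s₀ s₁ w = 0 ↔ w = 0 := by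
  unfold chart2
  split_ifs with h1 h2
  · simp only [show (4 : Fin 5) ≠ 0 by decide, false_iff]; rintro rfl
    have := congrArg Fin.val h1; simp at this
  · simp [h2]
  all_goals simp_all

/-- `chart2` is injective on pairs (anchor, anything) when the two anchors do not carry two different petals. [this work] -/
theorem chart2_eq_iff (k : ℕ) (s₀ s₁ : Fin (k + 2))
    (hs : s₀ ≠ Fin.last (k + 1) → s₀ ≠ 0 → s₁ ≠ Fin.last (k + 1) → s₁ ≠ 0 → s₀ = s₁)
    {a b : Fin (k + 2)} (ha : a = s₀ ∨ a = s₁) : a = b ↔ chart2 k s₀ s₁ a = chart2 k s₀ s₁ b := by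
  constructor
  · rintro rfl; rfl
  · intro h
    unfold chart2 at h
    split_ifs at h <;> first | (subst_vars; rfl) | simp_all
    all_goals (rcases ha with rfl | rfl <;> grind)

/-- **Submodularity of `kkK` on comparable rectangles of `M_k`** (reduced to the `M₃` table `kk_submod` through `chart2`). [this work] -/
theorem kkK_submod {k : ℕ} (s₀ s₁ t₀ t₁ : Fin (k + 2)) (hs : s₀ = s₁ ∨ s₀ = 0 ∨ s₁ = Fin.last (k + 1))
    (ht : t₀ = t₁ ∨ t₀ = 0 ∨ t₁ = Fin.last (k + 1)) :
    kkK k s₀ t₀ + kkK k s₁ t₁ ≤ kkK k s₁ t₀ + kkK k s₀ t₁ := by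
  set c := chart2 k s₀ s₁ with hc
  have hs' : s₀ ≠ Fin.last (k + 1) → s₀ ≠ 0 → s₁ ≠ Fin.last (k + 1) → s₁ ≠ 0 → s₀ = s₁ := by
    intro h1 h2 h3 _; rcases hs with h | h | h
    · exact h
    · exact absurd h h2
    · exact absurd h h3
  have e4 : (4 : Fin 5) = Fin.last (3 + 1) := rfl
  have T := fun w => e4 ▸ (chart2_eq_four_iff k s₀ s₁ w).symm
  have Z := fun w => (chart2_eq_zero_iff k s₀ s₁ w).symm
  have E0 : ∀ b, s₀ = b ↔ c s₀ = c b := fun b => chart2_eq_iff k s₀ s₁ hs' (Or.inl rfl)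
  have E1 : ∀ b, s₁ = b ↔ c s₁ = c b := fun b => chart2_eq_iff k s₀ s₁ hs' (Or.inr rfl)
  rw [kkK_congr (T s₀) (Z s₀) (T t₀) (Z t₀) (E0 t₀), kkK_congr (T s₁) (Z s₁) (T t₁) (Z t₁) (E1 t₁),
    kkK_congr (T s₁) (Z s₁) (T t₀) (Z t₀) (E1 t₀), kkK_congr (T s₀) (Z s₀) (T t₁) (Z t₁) (E0 t₁),
    kkK_three, kkK_three, kkK_three, kkK_three]
  refine kk_submod _ _ _ _ ?_ ?_
  · rcases hs with h | h | h
    · exact Or.inl (congrArg c h)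
    · exact Or.inr (Or.inl ((Z s₀).1 h))
    · exact Or.inr (Or.inr (e4 ▸ (T s₁).1 h))
  · -- comparability of `t₀ ≤ t₁` transports: equal, bottom or top
    rcases ht with h | h | h
    · exact Or.inl (congrArg c h)
    · exact Or.inr (Or.inl ((Z t₀).1 h))
    · exact Or.inr (Or.inr (e4 ▸ (T t₁).1 h))

namespace MSunflower

variable {α : Type*} [DecidableEq α] {k : ℕ} (F : MSunflower k α)

/-- **Monotonicity of the labelling** into the order of `M_k`. [this work] -/
theorem lab_mono {S T : Finset α} (hST : S ⊆ T) : F.lab S = F.lab T ∨ F.lab S = 0 ∨ F.lab T = Fin.last (k + 1) := by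
  by_cases hTA : T ∈ F.A
  · exact Or.inr (Or.inr ((F.lab_eq_last_iff T).2 hTA))
  have hSA : S ∉ F.A := fun h => hTA (F.upperA hST h)
  by_cases hex : ∃ i, S ∈ F.V i
  · obtain ⟨i, hi⟩ := hex
    exact Or.inl ((F.lab_eq_petalLab hSA hi).trans (F.lab_eq_petalLab hTA (F.upperV i hST hi)).symm)
  · exact Or.inr (Or.inl ((F.lab_eq_zero_iff S).2 ⟨hSA, fun i hi => hex ⟨i, hi⟩⟩))

/-- **Antipodal Gladkov with offsets, `k` petals**: for `G₂ ⊆ G₁`, `0 ≤ Σ_{S ⊆ W} kkK (lab (G₁ ∪ S)) (lab (G₂ ∪ (W ∖ S)))`. [this work] -/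
theorem antipodal_sum_nonneg (W : Finset α) :
    ∀ G₁ G₂ : Finset α, G₂ ⊆ G₁ → 0 ≤ ∑ S ∈ W.powerset, kkK k (F.lab (G₁ ∪ S)) (F.lab (G₂ ∪ (W \ S))) := by
  induction W using Finset.induction_on with
  | empty =>
    intro G₁ G₂ h
    simp only [powerset_empty, sum_singleton, union_empty, sdiff_self, bot_eq_empty]
    exact kkK_nonneg_of_mle _ _ (F.lab_mono h)
  | insert e W' he ih =>
    intro G₁ G₂ h
    rw [sum_powerset_insert he]
    have key : ∀ S ∈ W'.powerset,
        kkK k (F.lab (G₁ ∪ S)) (F.lab (G₂ ∪ (W' \ S))) + kkK k (F.lab (insert e G₁ ∪ S)) (F.lab (insert e G₂ ∪ (W' \ S)))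
          ≤ kkK k (F.lab (G₁ ∪ S)) (F.lab (G₂ ∪ (insert e W' \ S)))
            + kkK k (F.lab (G₁ ∪ insert e S)) (F.lab (G₂ ∪ (insert e W' \ insert e S))) := by
      intro S hS
      have hSW : S ⊆ W' := mem_powerset.1 hS
      have heS : e ∉ S := fun hx => he (hSW hx)
      rw [Sunflower.union_insert_sdiff heS, Sunflower.insert_sdiff_insert_of_not_mem he, Sunflower.union_insert_eq]
      have h1 := F.lab_mono (union_subset_union (subset_insert e G₁) (subset_refl S))
      have h2 := F.lab_mono (union_subset_union (subset_insert e G₂) (subset_refl (W' \ S)))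
      have := kkK_submod _ _ _ _ h1 h2
      linarith
    have hsum := sum_le_sum key
    rw [sum_add_distrib, sum_add_distrib] at hsum
    have ih1 := ih G₁ G₂ h
    have ih2 := ih (insert e G₁) (insert e G₂) (insert_subset_insert e h)
    linarith

/-- **Antipodal Gladkov, `k` petals**: `0 ≤ Σ_{S ⊆ W} kkK (lab S) (lab (W ∖ S))`. [this work] -/
theorem antipodal_gladkov (W : Finset α) : 0 ≤ ∑ S ∈ W.powerset, kkK k (F.lab S) (F.lab (W \ S)) := by
  have h := F.antipodal_sum_nonneg W ∅ ∅ (subset_refl _)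
  simpa only [empty_union] using h

variable [Fintype α]

/-- The spectator sum with weight `w`: `Σ_{(P¹,P²,P³)} w (lab P¹) · kkK (lab P²) (lab P³)`. [this work] -/
def SwK (w : Fin (k + 2) → ℤ) : ℤ := ∑ q ∈ parts α, w (F.lab q.1) * kkK k (F.lab q.2) (F.lab (q.1 ∪ q.2)ᶜ)

/-- The rainbow count `Σ triK` (`= 6 ×` the number of tri-petal rainbow partitions). [this work] -/
def NtriK : ℤ := ∑ q ∈ parts α, triK k (F.lab q.1) (F.lab q.2) (F.lab (q.1 ∪ q.2)ᶜ)

/-- Spectator sums with nonnegative weights are nonnegative. [this work] -/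
theorem SwK_nonneg (w : Fin (k + 2) → ℤ) (hw : ∀ v, 0 ≤ w v) : 0 ≤ F.SwK w := by
  unfold SwK
  rw [Sunflower.sum_parts_eq (f := fun S T => w (F.lab S) * kkK k (F.lab T) (F.lab (S ∪ T)ᶜ))]
  refine sum_nonneg fun S _ => ?_
  rw [← mul_sum]
  refine mul_nonneg (hw _) ?_
  have h := F.antipodal_gladkov Sᶜ
  refine le_of_le_of_eq h (sum_congr rfl fun T _ => ?_)
  rw [compl_union, sdiff_eq_inter_compl, inter_comm]

/-- `NtriK ≥ 0`. [this work] -/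
theorem NtriK_nonneg : 0 ≤ F.NtriK := by
  unfold NtriK; exact sum_nonneg fun q _ => triK_nonneg _ _ _ _

/-- **Spectator form**: `ZK = 3·SwK [decided] − NtriK`. [this work] -/
theorem ZK_eq_spec : F.ZK = 3 * F.SwK (decK k) - F.NtriK := by
  unfold ZK SwK NtriK
  have h2 : ∑ q ∈ parts α, decK k (F.lab q.2) * kkK k (F.lab q.1) (F.lab (q.1 ∪ q.2)ᶜ) =
      ∑ q ∈ parts α, decK k (F.lab q.1) * kkK k (F.lab q.2) (F.lab (q.1 ∪ q.2)ᶜ) :=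
    sum_parts_swap12 (fun A B C => decK k (F.lab B) * kkK k (F.lab A) (F.lab C))
  have h3 : ∑ q ∈ parts α, decK k (F.lab (q.1 ∪ q.2)ᶜ) * kkK k (F.lab q.1) (F.lab q.2) =
      ∑ q ∈ parts α, decK k (F.lab q.1) * kkK k (F.lab q.2) (F.lab (q.1 ∪ q.2)ᶜ) := by
    rw [show (∑ q ∈ parts α, decK k (F.lab (q.1 ∪ q.2)ᶜ) * kkK k (F.lab q.1) (F.lab q.2)) =
        ∑ q ∈ parts α, decK k (F.lab q.1) * kkK k (F.lab (q.1 ∪ q.2)ᶜ) (F.lab q.2) from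
      sum_parts_swap13 (fun A B C => decK k (F.lab C) * kkK k (F.lab A) (F.lab B))]
    exact sum_congr rfl fun q _ => by rw [kkK_comm k (F.lab (q.1 ∪ q.2)ᶜ) (F.lab q.2)]
  rw [show (∑ q ∈ parts α, s6K k (F.lab q.1) (F.lab q.2) (F.lab (q.1 ∪ q.2)ᶜ)) =
      ∑ q ∈ parts α, (decK k (F.lab q.1) * kkK k (F.lab q.2) (F.lab (q.1 ∪ q.2)ᶜ)
        + decK k (F.lab q.2) * kkK k (F.lab q.1) (F.lab (q.1 ∪ q.2)ᶜ)
        + decK k (F.lab (q.1 ∪ q.2)ᶜ) * kkK k (F.lab q.1) (F.lab q.2)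
        - triK k (F.lab q.1) (F.lab q.2) (F.lab (q.1 ∪ q.2)ᶜ)) from
    sum_congr rfl fun q _ => s6K_eq_spec k _ _ _]
  rw [sum_sub_distrib, sum_add_distrib, sum_add_distrib, h2, h3]
  ring

/-- `ZK + NtriK ≥ 0`: the rainbow count is the only negative term. [this work] -/
theorem ZK_add_NtriK_nonneg : 0 ≤ F.ZK + F.NtriK := by
  rw [F.ZK_eq_spec]
  have := F.SwK_nonneg (decK k) (fun v => by unfold decK; split_ifs <;> norm_num)
  linarith

/-- **★ₖ in the rainbow-free class**: `NtriK = 0 ⟹ 0 ≤ ZK`. [this work] -/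
theorem ZK_nonneg_of_NtriK_eq_zero (h : F.NtriK = 0) : 0 ≤ F.ZK := by
  have := F.ZK_add_NtriK_nonneg; linarith

/-- **★ₖ holds for `k ≤ 2` petals** (no rainbows exist). [this work] -/
theorem ZK_nonneg_of_le_two (hk : k ≤ 2) : 0 ≤ F.ZK := by
  refine F.ZK_nonneg_of_NtriK_eq_zero ?_
  unfold NtriK
  exact sum_eq_zero fun q _ => triK_eq_zero_of_le_two hk _ _ _

end MSunflower

end Summit.CriticalPhenomena.PercolationContinuityZ3.Theorems.SunflowerPartition
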